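import Summits.QuantumFields.BalabanUV.Beta.GAN24.TwoVertexWordContraction

/-!
# `BalabanUV.Beta.GAN24.SecondOrderInputsLinear` — binder row G-an2-4 ∕ (CONV-C), routes C-R6° («VALUES») × R7 («TWO CURRENCIES»), PART 206:
# THE INPUT CLASS OF THE `ℤ^d` END IS A `ℂ`-LINEAR SPACE CLOSED UNDER TRANSPOSE AND ADJOINT — so EVERY signed combination of the second-order shapes of census
# V196 (loop, two tadpoles, their transposes ∕ orderings) has the whole `LimitRate` END by ONE call, whatever row an1's sign ∕ placement convention turns out to be
# (unit b2b-balaban-gan24-p3, gen 63; v1)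

NOT IN PRINT; OUR PROOF ([folklore] bookkeeping BY NAME over PART 127 (`entryDecay_smul`), PART 130 (`entryDecay_add ∕ _neg ∕ _transpose ∕ _conjTranspose`,
`twoLevelDecayRate_add ∕ _neg ∕ _smul ∕ _transpose ∕ _conjTranspose ∕ _of_le_rate ∕ _const`), PART 135 (`entryDecay_of_le_rate`), PART 140 (`conv_of_decay_of_tendsto`),
PART 205 (`castT_zero`); [Balaban1987RG1] (1.20)–(1.22) p. 264 LOCATE the one-loop shapes; nothing printed is a hypothesis).
HONEST FRAMING (cell contract, verbatim): «discharging `BetaPertH` makes Bałaban's UV stability UNCONDITIONAL — a real constructive-QFT result; it is NOT the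
continuum limit and NOT the Clay problem.»  HONEST DEPENDENCY (verbatim): «continuum YM on T⁴ ⇐ BetaPertH ∧ nine spine estimates (0/9 proved); BetaPertH ⇐
(D1) ∧ (D4) ∧ CAP+tail; G-an2-4 gates asym, D1 and NE2/3/4.»

WHY.  PARTs 200 ∕ 203 ∕ 205 give the `ℤ^{d+1}` END of the three second-order SHAPES of census V196 one at a time, each through PART 140's socket, whose three inputs
are: (UD) `EntryDecay distK (c_{t,k}) B δ` for all `t, k`; (SR) `TwoLevelDecayRate distK (c_t) B′ δ θ` for all `t`; (EL) the entries read from the origin converge along the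
volumes.  Row an1's second-order coefficient is a SIGNED COMBINATION of these shapes with transposed ∕ re-ordered placements (census V202′ (a)).  This file records that
the INPUT class — with (EL) strengthened to ALL integer root pairs `(ẑ, ẑ′)`, which is what the suppliers actually prove — is closed under `+`, `−`, scalars, finite
`ℂ`-linear combinations, TRANSPOSE (needs the two-root (EL)) and ADJOINT, and under weakening of the rate; and that it feeds PART 140.  So the END of any signed
combination is one call once each shape's INPUTS (not only its END) are on record — PARTs 207ff. supply them in the literal-trace placements.

WHAT THIS FILE PROVES (0 sorry, 0 `def`; `n` a finite index type with a «distance», then the unit index sets `idx L (cubic d (side t)) 0` of the cubic tori):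
* §1 one torus: `entryDecay_zero`, `entryDecay_sub`, **`entryDecay_sum`**, `entryDecay_sum_smul`, `twoLevelDecayRate_zero`, **`twoLevelDecayRate_sum`**, `twoLevelDecayRate_sum_smul`.
* §2 volume families, the three inputs bundled as ONE conjunction `(UD) ∧ (SR) ∧ (EL at all integer root pairs)`: **`inputs_add`**, `inputs_neg`, `inputs_sub`, **`inputs_smul`**,
  **`inputs_sum_smul`** (finite `ℂ`-linear combinations: constants `Σ‖aᵢ‖Bᵢ`, `Σ‖aᵢ‖Bᵢ′`), **`inputs_transpose`**, **`inputs_conjTranspose`**, `inputs_of_le_rate`.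
* §3 **`conv_of_inputs`** — the bundle feeds PART 140 (origin (EL) is the pair `(ẑ, 0̂)`, `castT 0 = 0`): the whole `LimitRate` END; **`conv_sum_smul_of_inputs`** — the END of
  `Σᵢ aᵢ • c⁽ⁱ⁾` for any finite family of input bundles with a common rate and ratio.
WHAT IT DOES NOT DO: choose the signs (row an1); supply any shape's inputs (PARTs 207ff.); Bałaban's `Π⁰`.
SUPPLIER work; NEVER «G-an2-4 closed»; NOT (CONV-C), NOT D1, NOT `BetaPertH`, NOT continuum, NOT Clay.  Records: `HOME/b2b-balaban-gan24-p3/gen63/README.md`.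
-/

noncomputable section

open scoped BigOperators ComplexConjugate Matrix Matrix.Norms.L2Operator Kronecker
open Filter Topology Finset Matrix

namespace Summit.QuantumFields.BalabanUV.Beta.GAN24.SecondOrderInputsLinear

open Literature.MathematicalPhysics.QuantumFieldTheory.Balaban1983to89
open Literature.MathematicalPhysics.QuantumFieldTheory.Balaban1983to89.B5Prop11Plancherel (Tor fine)
open Literature.MathematicalPhysics.QuantumFieldTheory.Balaban1983to89.B12Sec2to5 (l1 betaPrime510)
open Literature.MathematicalPhysics.QuantumFieldTheory.Balaban1983to89.Beta (Site windowMap IsInfiniteVolumeLimit)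
open Literature.MathematicalPhysics.QuantumFieldTheory.Balaban1983to89.Beta.FreeLegDictionary (cubic)
open Literature.MathematicalPhysics.QuantumFieldTheory.Balaban1983to89.Beta.VectorTails (castT)
open Literature.MathematicalPhysics.QuantumFieldTheory.Balaban1983to89.Beta.LimitRate (StepRate limKernelOf KernelInputs)
open Summit.QuantumFields.BalabanUV.T4Continuum.BalabanAveragedTowerUnit (idx)
open Summit.QuantumFields.BalabanUV.T4Continuum.BalabanAveragedCoerciveTower (unitIdx)
open Summit.QuantumFields.BalabanUV.T4Continuum.CTKingTowerWeights (distK distK_comm)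
open Summit.QuantumFields.BalabanUV.T4Continuum.DecayRateInterpolation (EntryDecay TwoLevelDecayRate)
open Summit.QuantumFields.BalabanUV.Beta.GAN24.UnitLatticeDecayAlgebra (entryDecay_smul distK_nonneg)
open Summit.QuantumFields.BalabanUV.Beta.GAN24.EffectiveFormDecay (entryDecay_of_le_rate)
open Summit.QuantumFields.BalabanUV.Beta.GAN24.DiagramDecayAlgebra (entryDecay_add entryDecay_neg entryDecay_transpose entryDecay_conjTranspose twoLevelDecayRate_add
  twoLevelDecayRate_neg twoLevelDecayRate_smul twoLevelDecayRate_const twoLevelDecayRate_transpose twoLevelDecayRate_conjTranspose twoLevelDecayRate_of_le_rate)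
open Summit.QuantumFields.BalabanUV.Beta.GAN24.DiagramVolumeLimit (conv_of_decay_of_tendsto)
open Summit.QuantumFields.BalabanUV.Beta.GAN24.TwoVertexWordContraction (castT_zero)

variable {d : ℕ} (L : ℕ) [NeZero L]

/-! ## §1 One torus: finite sums of decaying kernels and of (SR) towers -/

section OneTorus

variable {n : Type*} [Fintype n] [DecidableEq n] {dist : n → n → ℝ} {ι : Type*}

omit [Fintype n] [DecidableEq n] in
/-- the zero kernel decays with constant `0`. [folklore] -/
theorem entryDecay_zero (δ : ℝ) : EntryDecay dist (0 : Matrix n n ℂ) 0 δ := by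
  intro x y; simp

omit [Fintype n] [DecidableEq n] in
/-- differences of decaying kernels decay (constants add). [folklore] -/
theorem entryDecay_sub {M N : Matrix n n ℂ} {B B' δ : ℝ} (hM : EntryDecay dist M B δ) (hN : EntryDecay dist N B' δ) :
    EntryDecay dist (M - N) (B + B') δ := by
  rw [sub_eq_add_neg]; exact entryDecay_add hM (entryDecay_neg hN)

omit [Fintype n] [DecidableEq n] in
/-- **finite sums of decaying kernels decay, constants add.** [folklore] -/
theorem entryDecay_sum (s : Finset ι) {M : ι → Matrix n n ℂ} {B : ι → ℝ} {δ : ℝ} (h : ∀ i ∈ s, EntryDecay dist (M i) (B i) δ) :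
    EntryDecay dist (∑ i ∈ s, M i) (∑ i ∈ s, B i) δ := by
  classical
  induction s using Finset.induction_on with
  | empty => simpa only [Finset.sum_empty] using entryDecay_zero (dist := dist) δ
  | insert a s ha ih =>
      rw [Finset.sum_insert ha, Finset.sum_insert ha]
      exact entryDecay_add (h a (Finset.mem_insert_self _ _)) (ih fun i hi => h i (Finset.mem_insert_of_mem hi))

omit [Fintype n] [DecidableEq n] in
/-- finite `ℂ`-linear combinations of decaying kernels decay with `Σ‖aᵢ‖Bᵢ`. [folklore] -/
theorem entryDecay_sum_smul (s : Finset ι) (a : ι → ℂ) {M : ι → Matrix n n ℂ} {B : ι → ℝ} {δ : ℝ} (h : ∀ i ∈ s, EntryDecay dist (M i) (B i) δ) :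
    EntryDecay dist (∑ i ∈ s, a i • M i) (∑ i ∈ s, ‖a i‖ * B i) δ :=
  entryDecay_sum s fun i hi => entryDecay_smul (h i hi) (a i)

omit [Fintype n] [DecidableEq n] in
/-- the zero tower has (SR) with constant `0`. [folklore] -/
theorem twoLevelDecayRate_zero (δ θ : ℝ) : TwoLevelDecayRate dist (fun _ => (0 : Matrix n n ℂ)) 0 δ θ :=
  twoLevelDecayRate_const 0 δ θ

omit [Fintype n] [DecidableEq n] in
/-- **(SR) under finite sums, constants add.** [folklore] -/
theorem twoLevelDecayRate_sum (s : Finset ι) {c : ι → ℕ → Matrix n n ℂ} {B : ι → ℝ} {δ θ : ℝ} (h : ∀ i ∈ s, TwoLevelDecayRate dist (c i) (B i) δ θ) :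
    TwoLevelDecayRate dist (fun k => ∑ i ∈ s, c i k) (∑ i ∈ s, B i) δ θ := by
  classical
  induction s using Finset.induction_on with
  | empty => simpa only [Finset.sum_empty] using twoLevelDecayRate_zero (dist := dist) δ θ
  | insert a s ha ih =>
      have h' := twoLevelDecayRate_add (h a (Finset.mem_insert_self _ _)) (ih fun i hi => h i (Finset.mem_insert_of_mem hi))
      simpa only [Finset.sum_insert ha] using h'

omit [Fintype n] [DecidableEq n] in
/-- (SR) under finite `ℂ`-linear combinations, constant `Σ‖aᵢ‖Bᵢ′`. [folklore] -/
theorem twoLevelDecayRate_sum_smul (s : Finset ι) (a : ι → ℂ) {c : ι → ℕ → Matrix n n ℂ} {B : ι → ℝ} {δ θ : ℝ}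
    (h : ∀ i ∈ s, TwoLevelDecayRate dist (c i) (B i) δ θ) :
    TwoLevelDecayRate dist (fun k => ∑ i ∈ s, a i • c i k) (∑ i ∈ s, ‖a i‖ * B i) δ θ :=
  twoLevelDecayRate_sum s fun i hi => twoLevelDecayRate_smul (h i hi) (a i)

end OneTorus

/-! ## §2 Volume families: the three inputs of PART 140 (with (EL) at all integer root pairs) as one bundle, and its closure properties -/

section Bundle

variable {side : ℕ → ℕ}

omit [NeZero L] in
/-- **`inputs_add` — THE INPUT BUNDLE IS ADDITIVE**: (UD) `B₁ + B₂`, (SR) `B₁′ + B₂′`, (EL) at every integer root pair. [folklore] -/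
theorem inputs_add {c₁ c₂ : (t : ℕ) → ℕ → Matrix (idx L (cubic d (side t)) 0) (idx L (cubic d (side t)) 0) ℂ} {B₁ B₁' B₂ B₂' δ θ : ℝ}
    (h₁ : (∀ t k, EntryDecay (distK L (cubic d (side t))) (c₁ t k) B₁ δ) ∧ (∀ t, TwoLevelDecayRate (distK L (cubic d (side t))) (c₁ t) B₁' δ θ) ∧
      (∀ k (μ ν : Fin d) (z z' : Fin d → ℤ), ∃ s : ℂ, Tendsto (fun t => c₁ t k ((unitIdx L (cubic d (side t))).symm (castT (cubic d (side t)) z, μ))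
        ((unitIdx L (cubic d (side t))).symm (castT (cubic d (side t)) z', ν))) atTop (𝓝 s)))
    (h₂ : (∀ t k, EntryDecay (distK L (cubic d (side t))) (c₂ t k) B₂ δ) ∧ (∀ t, TwoLevelDecayRate (distK L (cubic d (side t))) (c₂ t) B₂' δ θ) ∧
      (∀ k (μ ν : Fin d) (z z' : Fin d → ℤ), ∃ s : ℂ, Tendsto (fun t => c₂ t k ((unitIdx L (cubic d (side t))).symm (castT (cubic d (side t)) z, μ))
        ((unitIdx L (cubic d (side t))).symm (castT (cubic d (side t)) z', ν))) atTop (𝓝 s))) :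
    (∀ t k, EntryDecay (distK L (cubic d (side t))) (c₁ t k + c₂ t k) (B₁ + B₂) δ) ∧
      (∀ t, TwoLevelDecayRate (distK L (cubic d (side t))) (fun k => c₁ t k + c₂ t k) (B₁' + B₂') δ θ) ∧
      (∀ k (μ ν : Fin d) (z z' : Fin d → ℤ), ∃ s : ℂ, Tendsto (fun t => (c₁ t k + c₂ t k) ((unitIdx L (cubic d (side t))).symm (castT (cubic d (side t)) z, μ))
        ((unitIdx L (cubic d (side t))).symm (castT (cubic d (side t)) z', ν))) atTop (𝓝 s)) := by
  obtain ⟨hud₁, hsr₁, hel₁⟩ := h₁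
  obtain ⟨hud₂, hsr₂, hel₂⟩ := h₂
  refine ⟨fun t k => entryDecay_add (hud₁ t k) (hud₂ t k), fun t => twoLevelDecayRate_add (hsr₁ t) (hsr₂ t), fun k μ ν z z' => ?_⟩
  obtain ⟨s₁, hs₁⟩ := hel₁ k μ ν z z'
  obtain ⟨s₂, hs₂⟩ := hel₂ k μ ν z z'
  exact ⟨s₁ + s₂, by simpa only [Matrix.add_apply] using hs₁.add hs₂⟩

omit [NeZero L] in
/-- `inputs_neg` — the bundle under negation (same constants). [folklore] -/
theorem inputs_neg {c : (t : ℕ) → ℕ → Matrix (idx L (cubic d (side t)) 0) (idx L (cubic d (side t)) 0) ℂ} {B B' δ θ : ℝ}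
    (h : (∀ t k, EntryDecay (distK L (cubic d (side t))) (c t k) B δ) ∧ (∀ t, TwoLevelDecayRate (distK L (cubic d (side t))) (c t) B' δ θ) ∧
      (∀ k (μ ν : Fin d) (z z' : Fin d → ℤ), ∃ s : ℂ, Tendsto (fun t => c t k ((unitIdx L (cubic d (side t))).symm (castT (cubic d (side t)) z, μ))
        ((unitIdx L (cubic d (side t))).symm (castT (cubic d (side t)) z', ν))) atTop (𝓝 s))) :
    (∀ t k, EntryDecay (distK L (cubic d (side t))) (-c t k) B δ) ∧
      (∀ t, TwoLevelDecayRate (distK L (cubic d (side t))) (fun k => -c t k) B' δ θ) ∧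
      (∀ k (μ ν : Fin d) (z z' : Fin d → ℤ), ∃ s : ℂ, Tendsto (fun t => (-c t k) ((unitIdx L (cubic d (side t))).symm (castT (cubic d (side t)) z, μ))
        ((unitIdx L (cubic d (side t))).symm (castT (cubic d (side t)) z', ν))) atTop (𝓝 s)) := by
  obtain ⟨hud, hsr, hel⟩ := h
  refine ⟨fun t k => entryDecay_neg (hud t k), fun t => twoLevelDecayRate_neg (hsr t), fun k μ ν z z' => ?_⟩
  obtain ⟨s, hs⟩ := hel k μ ν z z'
  exact ⟨-s, by simpa only [Matrix.neg_apply] using hs.neg⟩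

omit [NeZero L] in
/-- `inputs_sub` — the bundle under differences (constants add). [folklore] -/
theorem inputs_sub {c₁ c₂ : (t : ℕ) → ℕ → Matrix (idx L (cubic d (side t)) 0) (idx L (cubic d (side t)) 0) ℂ} {B₁ B₁' B₂ B₂' δ θ : ℝ}
    (h₁ : (∀ t k, EntryDecay (distK L (cubic d (side t))) (c₁ t k) B₁ δ) ∧ (∀ t, TwoLevelDecayRate (distK L (cubic d (side t))) (c₁ t) B₁' δ θ) ∧
      (∀ k (μ ν : Fin d) (z z' : Fin d → ℤ), ∃ s : ℂ, Tendsto (fun t => c₁ t k ((unitIdx L (cubic d (side t))).symm (castT (cubic d (side t)) z, μ))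
        ((unitIdx L (cubic d (side t))).symm (castT (cubic d (side t)) z', ν))) atTop (𝓝 s)))
    (h₂ : (∀ t k, EntryDecay (distK L (cubic d (side t))) (c₂ t k) B₂ δ) ∧ (∀ t, TwoLevelDecayRate (distK L (cubic d (side t))) (c₂ t) B₂' δ θ) ∧
      (∀ k (μ ν : Fin d) (z z' : Fin d → ℤ), ∃ s : ℂ, Tendsto (fun t => c₂ t k ((unitIdx L (cubic d (side t))).symm (castT (cubic d (side t)) z, μ))
        ((unitIdx L (cubic d (side t))).symm (castT (cubic d (side t)) z', ν))) atTop (𝓝 s))) :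
    (∀ t k, EntryDecay (distK L (cubic d (side t))) (c₁ t k - c₂ t k) (B₁ + B₂) δ) ∧
      (∀ t, TwoLevelDecayRate (distK L (cubic d (side t))) (fun k => c₁ t k - c₂ t k) (B₁' + B₂') δ θ) ∧
      (∀ k (μ ν : Fin d) (z z' : Fin d → ℤ), ∃ s : ℂ, Tendsto (fun t => (c₁ t k - c₂ t k) ((unitIdx L (cubic d (side t))).symm (castT (cubic d (side t)) z, μ))
        ((unitIdx L (cubic d (side t))).symm (castT (cubic d (side t)) z', ν))) atTop (𝓝 s)) := by
  have h := inputs_add L h₁ (inputs_neg L h₂)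
  simpa only [← sub_eq_add_neg] using h

omit [NeZero L] in
/-- **`inputs_smul` — THE INPUT BUNDLE UNDER A FIXED SCALAR `a : ℂ`**: constants `‖a‖B`, `‖a‖B′`. [folklore] -/
theorem inputs_smul {c : (t : ℕ) → ℕ → Matrix (idx L (cubic d (side t)) 0) (idx L (cubic d (side t)) 0) ℂ} {B B' δ θ : ℝ}
    (h : (∀ t k, EntryDecay (distK L (cubic d (side t))) (c t k) B δ) ∧ (∀ t, TwoLevelDecayRate (distK L (cubic d (side t))) (c t) B' δ θ) ∧
      (∀ k (μ ν : Fin d) (z z' : Fin d → ℤ), ∃ s : ℂ, Tendsto (fun t => c t k ((unitIdx L (cubic d (side t))).symm (castT (cubic d (side t)) z, μ))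
        ((unitIdx L (cubic d (side t))).symm (castT (cubic d (side t)) z', ν))) atTop (𝓝 s))) (a : ℂ) :
    (∀ t k, EntryDecay (distK L (cubic d (side t))) (a • c t k) (‖a‖ * B) δ) ∧
      (∀ t, TwoLevelDecayRate (distK L (cubic d (side t))) (fun k => a • c t k) (‖a‖ * B') δ θ) ∧
      (∀ k (μ ν : Fin d) (z z' : Fin d → ℤ), ∃ s : ℂ, Tendsto (fun t => (a • c t k) ((unitIdx L (cubic d (side t))).symm (castT (cubic d (side t)) z, μ))
        ((unitIdx L (cubic d (side t))).symm (castT (cubic d (side t)) z', ν))) atTop (𝓝 s)) := by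
  obtain ⟨hud, hsr, hel⟩ := h
  refine ⟨fun t k => entryDecay_smul (hud t k) a, fun t => twoLevelDecayRate_smul (hsr t) a, fun k μ ν z z' => ?_⟩
  obtain ⟨s, hs⟩ := hel k μ ν z z'
  exact ⟨a * s, by simpa only [Matrix.smul_apply, smul_eq_mul] using hs.const_mul a⟩

omit [NeZero L] in
/-- **`inputs_sum_smul` — THE INPUT BUNDLE UNDER FINITE `ℂ`-LINEAR COMBINATIONS** (`s` a finite set of labels, coefficients `aᵢ`, a common rate `δ` and ratio `θ`):
constants `Σ_{i∈s}‖aᵢ‖Bᵢ` and `Σ_{i∈s}‖aᵢ‖Bᵢ′`. [folklore] -/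
theorem inputs_sum_smul {ι : Type*} (s : Finset ι) (a : ι → ℂ)
    {c : ι → (t : ℕ) → ℕ → Matrix (idx L (cubic d (side t)) 0) (idx L (cubic d (side t)) 0) ℂ} {B B' : ι → ℝ} {δ θ : ℝ}
    (h : ∀ i ∈ s, (∀ t k, EntryDecay (distK L (cubic d (side t))) (c i t k) (B i) δ) ∧ (∀ t, TwoLevelDecayRate (distK L (cubic d (side t))) (c i t) (B' i) δ θ) ∧
      (∀ k (μ ν : Fin d) (z z' : Fin d → ℤ), ∃ s' : ℂ, Tendsto (fun t => c i t k ((unitIdx L (cubic d (side t))).symm (castT (cubic d (side t)) z, μ))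
        ((unitIdx L (cubic d (side t))).symm (castT (cubic d (side t)) z', ν))) atTop (𝓝 s'))) :
    (∀ t k, EntryDecay (distK L (cubic d (side t))) (∑ i ∈ s, a i • c i t k) (∑ i ∈ s, ‖a i‖ * B i) δ) ∧
      (∀ t, TwoLevelDecayRate (distK L (cubic d (side t))) (fun k => ∑ i ∈ s, a i • c i t k) (∑ i ∈ s, ‖a i‖ * B' i) δ θ) ∧
      (∀ k (μ ν : Fin d) (z z' : Fin d → ℤ), ∃ s' : ℂ, Tendsto (fun t => (∑ i ∈ s, a i • c i t k) ((unitIdx L (cubic d (side t))).symm (castT (cubic d (side t)) z, μ))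
        ((unitIdx L (cubic d (side t))).symm (castT (cubic d (side t)) z', ν))) atTop (𝓝 s')) := by
  refine ⟨fun t k => entryDecay_sum_smul s a fun i hi => (h i hi).1 t k, fun t => twoLevelDecayRate_sum_smul s a fun i hi => (h i hi).2.1 t, fun k μ ν z z' => ?_⟩
  have hel : ∀ i ∈ s, ∃ s' : ℂ, Tendsto (fun t => (a i • c i t k) ((unitIdx L (cubic d (side t))).symm (castT (cubic d (side t)) z, μ))
      ((unitIdx L (cubic d (side t))).symm (castT (cubic d (side t)) z', ν))) atTop (𝓝 s') := fun i hi => by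
    obtain ⟨s', hs'⟩ := (h i hi).2.2 k μ ν z z'
    exact ⟨a i * s', by simpa only [Matrix.smul_apply, smul_eq_mul] using hs'.const_mul (a i)⟩
  choose! S hS using hel
  refine ⟨∑ i ∈ s, S i, ?_⟩
  have e : ∀ t, (∑ i ∈ s, a i • c i t k) ((unitIdx L (cubic d (side t))).symm (castT (cubic d (side t)) z, μ)) ((unitIdx L (cubic d (side t))).symm (castT (cubic d (side t)) z', ν))
      = ∑ i ∈ s, (a i • c i t k) ((unitIdx L (cubic d (side t))).symm (castT (cubic d (side t)) z, μ)) ((unitIdx L (cubic d (side t))).symm (castT (cubic d (side t)) z', ν)) :=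
    fun t => by rw [Matrix.sum_apply]
  simp only [e]
  exact tendsto_finsetSum s fun i hi => hS i hi

omit [NeZero L] in
/-- **`inputs_transpose` — THE INPUT BUNDLE UNDER TRANSPOSE** (`distK` is symmetric; the two-root (EL) is what makes this free). [folklore] -/
theorem inputs_transpose [∀ t, NeZero (side t)] {c : (t : ℕ) → ℕ → Matrix (idx L (cubic d (side t)) 0) (idx L (cubic d (side t)) 0) ℂ} {B B' δ θ : ℝ}
    (h : (∀ t k, EntryDecay (distK L (cubic d (side t))) (c t k) B δ) ∧ (∀ t, TwoLevelDecayRate (distK L (cubic d (side t))) (c t) B' δ θ) ∧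
      (∀ k (μ ν : Fin d) (z z' : Fin d → ℤ), ∃ s : ℂ, Tendsto (fun t => c t k ((unitIdx L (cubic d (side t))).symm (castT (cubic d (side t)) z, μ))
        ((unitIdx L (cubic d (side t))).symm (castT (cubic d (side t)) z', ν))) atTop (𝓝 s))) :
    (∀ t k, EntryDecay (distK L (cubic d (side t))) (c t k)ᵀ B δ) ∧
      (∀ t, TwoLevelDecayRate (distK L (cubic d (side t))) (fun k => (c t k)ᵀ) B' δ θ) ∧
      (∀ k (μ ν : Fin d) (z z' : Fin d → ℤ), ∃ s : ℂ, Tendsto (fun t => (c t k)ᵀ ((unitIdx L (cubic d (side t))).symm (castT (cubic d (side t)) z, μ))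
        ((unitIdx L (cubic d (side t))).symm (castT (cubic d (side t)) z', ν))) atTop (𝓝 s)) := by
  obtain ⟨hud, hsr, hel⟩ := h
  refine ⟨fun t k => entryDecay_transpose (distK_comm L (cubic d (side t))) (hud t k),
    fun t => twoLevelDecayRate_transpose (distK_comm L (cubic d (side t))) (hsr t), fun k μ ν z z' => ?_⟩
  obtain ⟨s, hs⟩ := hel k ν μ z' z
  exact ⟨s, by simpa only [Matrix.transpose_apply] using hs⟩

omit [NeZero L] in
/-- **`inputs_conjTranspose` — THE INPUT BUNDLE UNDER ADJOINTS** (entrywise conjugation is continuous and norm-preserving). [folklore] -/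
theorem inputs_conjTranspose [∀ t, NeZero (side t)] {c : (t : ℕ) → ℕ → Matrix (idx L (cubic d (side t)) 0) (idx L (cubic d (side t)) 0) ℂ} {B B' δ θ : ℝ}
    (h : (∀ t k, EntryDecay (distK L (cubic d (side t))) (c t k) B δ) ∧ (∀ t, TwoLevelDecayRate (distK L (cubic d (side t))) (c t) B' δ θ) ∧
      (∀ k (μ ν : Fin d) (z z' : Fin d → ℤ), ∃ s : ℂ, Tendsto (fun t => c t k ((unitIdx L (cubic d (side t))).symm (castT (cubic d (side t)) z, μ))
        ((unitIdx L (cubic d (side t))).symm (castT (cubic d (side t)) z', ν))) atTop (𝓝 s))) :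
    (∀ t k, EntryDecay (distK L (cubic d (side t))) (c t k)ᴴ B δ) ∧
      (∀ t, TwoLevelDecayRate (distK L (cubic d (side t))) (fun k => (c t k)ᴴ) B' δ θ) ∧
      (∀ k (μ ν : Fin d) (z z' : Fin d → ℤ), ∃ s : ℂ, Tendsto (fun t => (c t k)ᴴ ((unitIdx L (cubic d (side t))).symm (castT (cubic d (side t)) z, μ))
        ((unitIdx L (cubic d (side t))).symm (castT (cubic d (side t)) z', ν))) atTop (𝓝 s)) := by
  obtain ⟨hud, hsr, hel⟩ := h
  refine ⟨fun t k => entryDecay_conjTranspose (distK_comm L (cubic d (side t))) (hud t k),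
    fun t => twoLevelDecayRate_conjTranspose (distK_comm L (cubic d (side t))) (hsr t), fun k μ ν z z' => ?_⟩
  obtain ⟨s, hs⟩ := hel k ν μ z' z
  exact ⟨star s, by simpa only [Matrix.conjTranspose_apply] using hs.star⟩

omit [NeZero L] in
/-- `inputs_of_le_rate` — the bundle at rate `δ` is one at every rate `δ′ ≤ δ` (`B, B′, θ ≥ 0`). [folklore] -/
theorem inputs_of_le_rate {c : (t : ℕ) → ℕ → Matrix (idx L (cubic d (side t)) 0) (idx L (cubic d (side t)) 0) ℂ} {B B' δ δ' θ : ℝ}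
    (hB : 0 ≤ B) (hB' : 0 ≤ B') (hθ : 0 ≤ θ) (hδ : δ' ≤ δ)
    (h : (∀ t k, EntryDecay (distK L (cubic d (side t))) (c t k) B δ) ∧ (∀ t, TwoLevelDecayRate (distK L (cubic d (side t))) (c t) B' δ θ) ∧
      (∀ k (μ ν : Fin d) (z z' : Fin d → ℤ), ∃ s : ℂ, Tendsto (fun t => c t k ((unitIdx L (cubic d (side t))).symm (castT (cubic d (side t)) z, μ))
        ((unitIdx L (cubic d (side t))).symm (castT (cubic d (side t)) z', ν))) atTop (𝓝 s))) :
    (∀ t k, EntryDecay (distK L (cubic d (side t))) (c t k) B δ') ∧ (∀ t, TwoLevelDecayRate (distK L (cubic d (side t))) (c t) B' δ' θ) ∧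
      (∀ k (μ ν : Fin d) (z z' : Fin d → ℤ), ∃ s : ℂ, Tendsto (fun t => c t k ((unitIdx L (cubic d (side t))).symm (castT (cubic d (side t)) z, μ))
        ((unitIdx L (cubic d (side t))).symm (castT (cubic d (side t)) z', ν))) atTop (𝓝 s)) :=
  ⟨fun t k => entryDecay_of_le_rate (distK_nonneg L (cubic d (side t))) (h.1 t k) hB hδ,
    fun t => twoLevelDecayRate_of_le_rate (distK_nonneg L (cubic d (side t))) (h.2.1 t) hB' hθ hδ, h.2.2⟩

end Bundle

/-! ## §3 The bundle feeds PART 140: the END of one bundle, and of any finite `ℂ`-linear combination -/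

section End

variable {side : ℕ → ℕ} [∀ t, NeZero (side t)]

/-- **`conv_of_inputs` — THE `ℤ^d` END OF AN INPUT BUNDLE** (`d ≥ 1`, `side t → ∞`, `δ > 0`, `0 ≤ θ < 1`, `μ ≠ ν`): PART 140's `conv_of_decay_of_tendsto` with its origin (EL) read off
the two-root (EL) at the pair `(ẑ, 0̂)` (`castT 0 = 0`). [cite: Balaban1987RG1, (1.21)–(1.22) p.264 (shapes)] [folklore] -/
theorem conv_of_inputs (hd : 1 ≤ d) (hside : Tendsto side atTop atTop)
    {c : (t : ℕ) → ℕ → Matrix (idx L (cubic d (side t)) 0) (idx L (cubic d (side t)) 0) ℂ} {B B' δ θ : ℝ} (hδ : 0 < δ) (hθ0 : 0 ≤ θ) (hθ1 : θ < 1)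
    (h : (∀ t k, EntryDecay (distK L (cubic d (side t))) (c t k) B δ) ∧ (∀ t, TwoLevelDecayRate (distK L (cubic d (side t))) (c t) B' δ θ) ∧
      (∀ k (μ ν : Fin d) (z z' : Fin d → ℤ), ∃ s : ℂ, Tendsto (fun t => c t k ((unitIdx L (cubic d (side t))).symm (castT (cubic d (side t)) z, μ))
        ((unitIdx L (cubic d (side t))).symm (castT (cubic d (side t)) z', ν))) atTop (𝓝 s)))
    {μ ν : Fin d} (hne : μ ≠ ν) :
    ∃ Pinf : ℕ → B12Beta.Kernel d,
      (∀ k, IsInfiniteVolumeLimit side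
        (fun t μ' ν' (z : Site d (side t)) => (c t k ((unitIdx L (cubic d (side t))).symm (z, μ')) ((unitIdx L (cubic d (side t))).symm (0, ν'))).re) (Pinf k)) ∧
      Beta.LimitRate.UniformDecay Pinf μ ν B (δ / d) ∧ StepRate Pinf μ ν B' (δ / d) θ ∧
      (∃ K : KernelInputs d Pinf, K.θ = θ ∧ K.c₀ = betaPrime510 d (B' / (1 - θ)) (δ / d) ∧ K.Pinf = limKernelOf Pinf ∧ K.μ = μ ∧ K.ν = ν) ∧
      (∀ k, |B12Beta.secondMoment (Pinf k) μ ν - B12Beta.secondMoment (limKernelOf Pinf) μ ν| ≤ betaPrime510 d (B' / (1 - θ)) (δ / d) * θ ^ k) := by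
  refine conv_of_decay_of_tendsto L hd hside hδ hθ0 hθ1 h.1 h.2.1 (fun k μ' ν' z => ?_) hne
  obtain ⟨s, hs⟩ := h.2.2 k μ' ν' z 0
  refine ⟨s, hs.congr fun t => ?_⟩
  rw [castT_zero]

/-- **`conv_sum_smul_of_inputs` — THE `ℤ^d` END OF ANY FINITE `ℂ`-LINEAR COMBINATION OF INPUT BUNDLES** (common rate `δ > 0` and ratio `0 ≤ θ < 1`; `d ≥ 1`, `side t → ∞`,
`μ ≠ ν`): the tower `Σ_{i∈s} aᵢ • c⁽ⁱ⁾_{t,k}` has limit kernels `Π` with `IsInfiniteVolumeLimit`, `UniformDecay Π μ ν (Σ‖aᵢ‖Bᵢ) (δ∕d)`, `StepRate Π μ ν (Σ‖aᵢ‖Bᵢ′) (δ∕d) θ`,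
`KernelInputs d Π`, second-moment convergence — §2 `inputs_sum_smul` + `conv_of_inputs`.  This is the END of row an1's signed second-order combination for ANY
choice of signs ∕ coefficients, once each shape's inputs are on record. [cite: Balaban1987RG1, (1.20)–(1.22) p.264 (shapes)] [folklore] -/
theorem conv_sum_smul_of_inputs (hd : 1 ≤ d) (hside : Tendsto side atTop atTop) {ι : Type*} (s : Finset ι) (a : ι → ℂ)
    {c : ι → (t : ℕ) → ℕ → Matrix (idx L (cubic d (side t)) 0) (idx L (cubic d (side t)) 0) ℂ} {B B' : ι → ℝ} {δ θ : ℝ} (hδ : 0 < δ) (hθ0 : 0 ≤ θ) (hθ1 : θ < 1)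
    (h : ∀ i ∈ s, (∀ t k, EntryDecay (distK L (cubic d (side t))) (c i t k) (B i) δ) ∧ (∀ t, TwoLevelDecayRate (distK L (cubic d (side t))) (c i t) (B' i) δ θ) ∧
      (∀ k (μ ν : Fin d) (z z' : Fin d → ℤ), ∃ s' : ℂ, Tendsto (fun t => c i t k ((unitIdx L (cubic d (side t))).symm (castT (cubic d (side t)) z, μ))
        ((unitIdx L (cubic d (side t))).symm (castT (cubic d (side t)) z', ν))) atTop (𝓝 s')))
    {μ ν : Fin d} (hne : μ ≠ ν) :
    ∃ Pinf : ℕ → B12Beta.Kernel d,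
      (∀ k, IsInfiniteVolumeLimit side
        (fun t μ' ν' (z : Site d (side t)) => ((∑ i ∈ s, a i • c i t k) ((unitIdx L (cubic d (side t))).symm (z, μ')) ((unitIdx L (cubic d (side t))).symm (0, ν'))).re) (Pinf k)) ∧
      Beta.LimitRate.UniformDecay Pinf μ ν (∑ i ∈ s, ‖a i‖ * B i) (δ / d) ∧ StepRate Pinf μ ν (∑ i ∈ s, ‖a i‖ * B' i) (δ / d) θ ∧
      (∃ K : KernelInputs d Pinf, K.θ = θ ∧ K.c₀ = betaPrime510 d ((∑ i ∈ s, ‖a i‖ * B' i) / (1 - θ)) (δ / d) ∧ K.Pinf = limKernelOf Pinf ∧ K.μ = μ ∧ K.ν = ν) ∧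
      (∀ k, |B12Beta.secondMoment (Pinf k) μ ν - B12Beta.secondMoment (limKernelOf Pinf) μ ν| ≤ betaPrime510 d ((∑ i ∈ s, ‖a i‖ * B' i) / (1 - θ)) (δ / d) * θ ^ k) :=
  conv_of_inputs L hd hside (c := fun t k => ∑ i ∈ s, a i • c i t k) hδ hθ0 hθ1 (inputs_sum_smul L s a h) hne

end End

end Summit.QuantumFields.BalabanUV.Beta.GAN24.SecondOrderInputsLinear

end
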